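/-
Copyright (c) 2026 the pub-hodgecm-mathlib formalisation cell (harness21).  Prover seat hodgecm-mathlib-K2Liu-p27 (g0), Track B «K2-LIT»,
#184♮ = hLiu418 = `stmt-HodgeConjecture-24832`; #42S organ S2, census (G5) Fock half (co-dealer K2E5-plan (g7) 2026-09-04T15:18:09Z «p27's next = (G5-Fock)»;
desk K2Liu-p05 (g6) 15:10:35Z (B) ∕ 15:14:39Z; LEAD F0P6-plan (g14) BATCH #45∕#46).
-/
import Summits.HodgeConjecture.HodgeConjecture.Theorems.K2LiuArchSWSystemRealiser       -- ★ (real) `realiser_of_hK` (+ ★ σ15 `isArchDatum_hermiteSpan`)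
import Literature.RepresentationTheory.KonnoKonno2007.JunctionWeilDatumGeneralRank     -- ★ `weilRepPair_apply`, `weilElt_toBig_κ_apply` (every signature)
import Literature.Analysis.SegalBargmann.SchwartzBargmannIntertwining                   -- ★ `unitaryOpPi_binvPi`, `binvPi_zeta`, `binvPiₗ`
import Literature.Analysis.SegalBargmann.FockInfinitesimalAction                         -- ★ `totalDegree_linSubst_le`
import Literature.Analysis.SegalBargmann.SchwartzIsotypicFockPolynomials                 -- ★ `isHomogeneous_zeta`
import HarnessLib

/-!
# Crux `HLiu418`, #42S organ S2, census (G5), the FOCK HALF: EVERY ONE-PLACE FRAME COMPACT HAS σ15's FOCK PROPERTY —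
# `ω(κ k) h_β ∈ span {h_γ : |γ| ≤ |β|}` at every signature; hence σ15's `hK` and the (real) clause need only the BARE inclusion
# «the arch part of `𝒦.K` lies in the submonoid generated by the frame compacts `placeSec_𝔻 σ (kV k₁)`»

Cell `hodgecm-mathlib`, crux item hLiu418 = `stmt-HodgeConjecture-24832`; squad K2 ∕ K2Liu; LEAD F0P6-plan (g14), co-dealer K2E5-plan (g7), S2 desk K2Liu-p05 (g6); prover
K2Liu-p27 (g0).  THEOREMS ONLY (no `def`, no instance, no notation, no named-fact hypothesis, no `sorry`); lane `--supports stmt-HodgeConjecture-24832 --as helper`.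

WHY.  ★ σ15 `K2LiuArchHermiteDatum.isArchDatum_hermiteSpan` (and after it ★ `K2LiuArchSWSystemRealiser.realiser_of_hK`, the (real) clause of the `hval` instance) carry the
binder `hK`: every arch element of `𝒦.K` lies in the submonoid of `H(L⁺ ⊗ ℝ)` generated by one-place elements `placeSec_𝔻 σ h`, `h ∈ U(p_σ, q_σ)`, HAVING THE FOCK PROPERTY
«`ω(h ⊗ 1) h_{β₁} ∈ span {h_γ : |γ| ≤ |β₁|}` for every multi-index `β₁`» (`ω = weilRep ∘ toBig` the junction Weil representation of `U(p_σ,q_σ) × U(r_σ,s_σ)`).  Census (G5)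
splits `hK` into (i) a GROUP-THEORETIC inclusion — the arch part of `𝒦.K` is generated by the frame compacts `placeSec_𝔻 σ (kV k₁)`, `k₁ ∈ U(p_σ) × U(q_σ)` — and (ii) the
FOCK PROPERTY of those compacts.  This file proves (ii) outright, at EVERY signature `(P, Q, R, S)` (no `Fin 2`), and re-issues σ15 and the (real) clause with `hK`
replaced by the bare inclusion (i) (`hK₀`).  HONEST: (i) is NOT a consequence of ★ `IwasawaDatum.IsStd` — (P2) of `IsStd` makes the arch part the stabiliser of SOME
positive majorant (frame `S` existential), while the frame compacts generate the one maximal compact `∏_σ U(p_σ) × U(q_σ)` of the DIAGONAL frame of `J^𝔻 = hermD`; (i)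
holds iff the datum's majorant is the diagonal one, so it stays a binder on `𝒦`.
* §1 (generic index `σ`): `binvPi_mem_span_hermitePi` — `B⁻¹F ∈ span {h_γ : |γ| ≤ d}` for `deg F ≤ d` (`F = Σ_m c_m ζ_m ∕ hcoef`, ★ `binvPi_zeta`); `unitaryOpPi_hermitePi_mem_span` —
  Folland's `μ₀(U) h_β = B⁻¹(ζ_β ∘ U⁻¹) ∈ span {h_γ : |γ| ≤ |β|}` (★ `unitaryOpPi_binvPi`, ★ `totalDegree_linSubst_le`, ★ `isHomogeneous_zeta`).
* §2 (dual pair `U(P,Q) × U(R,S)`): `weilRepPair_κ_hermitePi_mem_span` — `ω(κ k) h_β = (det d)⁻¹ · μ₀(ι k) h_β` (★ `weilElt_toBig_κ_apply`, every signature) lies in the span;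
  `weilRepPair_kV_one_hermitePi_mem_span` — the literal shape of σ15's Fock clause, `ω((kV k₁, 1)) h_β`.
* §3 (σ15's setting): `isArchDatum_hermiteSpan_of_closure_kV` and `realiser_of_closure_kV` — ★ σ15 ∕ ★ (real) with `hK` replaced by `hK₀` (bare inclusion), all other
  binders byte for byte (`Submonoid.closure_mono` + §2).
References: [Folland1989] §1.7, Prop. (4.39); [Howe1989] §3; [KonnoKonno2007] §3.1, §3.3, Lemma 5.2; [HarrisKudlaSweet1996] §1 (1.15)–(1.17).
HONEST LABEL.  Count-neutral helper: `HC_CM` is proved only modulo the 7 printed citations (2 remaining named inputs: hLiu418 = `stmt-HodgeConjecture-24832`,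
h413 = `stmt-HodgeConjecture-24833`) until rung 0 closes; this file closes no socket.
-/

set_option autoImplicit false
set_option linter.dupNamespace false -- the mandated namespace repeats `HodgeConjecture.HodgeConjecture`
set_option synthInstance.maxSize 512 -- `DecidableEq` of the nested block index (as ★ σ15 `K2LiuArchHermiteDatum`)

noncomputable section

open scoped Classical Matrix TensorProduct Kronecker SchwartzMap
open NumberField NumberField.InfinitePlace NumberField.mixedEmbedding IsDedekindDomain
open Literature.Analysis.SegalBargmann Literature.RepresentationTheory.HeisenbergGroup
open Literature.NumberTheory.Automorphic Literature.NumberTheory.Automorphic.UnitaryGroup Literature.NumberTheory.GaloisRepresentations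
open Literature.NumberTheory.Weil1964 Literature.NumberTheory.Weil1964.MpS Literature.NumberTheory.Weil1964.UnitaryWeil
open Literature.RepresentationTheory.HarrisKudlaSweet1996
open Literature.RepresentationTheory.KonnoKonno2007 Literature.RepresentationTheory.KonnoKonno2007.RealDualPair
open Literature.NumberTheory.GelbartRogawski1991 Literature.NumberTheory.GelbartRogawski1991.GRConstruction
open Literature.NumberTheory.GelbartRogawski1991.UnitaryDualPair
open Literature.NumberTheory.GelbartRogawski1991.UnitaryDualPair.LocalSplitting
open Literature.NumberTheory.K2Lit.SiegelDoubled
open Summit.HodgeConjecture.HodgeConjecture.Cruxes.HLiu418.K2LiuArchSectionPlaceBlock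
open Summit.HodgeConjecture.HodgeConjecture.Cruxes.HLiu418.K2LiuWeilSeesawRelabel
open Summit.HodgeConjecture.HodgeConjecture.Cruxes.HLiu418.K2LiuArchTensorPlaceSec
open Summit.HodgeConjecture.HodgeConjecture.Cruxes.HLiu418.K2LiuArchHermiteGlue
open Summit.HodgeConjecture.HodgeConjecture.Cruxes.HLiu418.K2LiuArchSWImageDefs
open Summit.HodgeConjecture.HodgeConjecture.Cruxes.HLiu418.K2LiuArchSWSpanningDefs
open Summit.HodgeConjecture.HodgeConjecture.Cruxes.HLiu418.K2LiuArchHermiteDatum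
open Summit.HodgeConjecture.HodgeConjecture.Cruxes.HLiu418.K2LiuArchSWSystemRealiser

namespace Summit.HodgeConjecture.HodgeConjecture.Cruxes.HLiu418.K2LiuArchPlaceSecFockDegree

/-! ## §1 Generic: Bargmann images of bounded degree and Folland's `μ₀(U)` on Hermite functions -/

section Generic

variable {ι : Type*} [Fintype ι] [DecidableEq ι]

omit [Fintype ι] [DecidableEq ι] in
/-- `|s| = Σ_i s_i`: the exponent sum of `MvPolynomial.totalDegree` IS `Finsupp.degree`. [folklore] -/
theorem sum_eq_degree (s : ι →₀ ℕ) : (s.sum fun _ e => e) = s.degree := rfl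

/-- **`B⁻¹F ∈ span {h_γ : |γ| ≤ d}` for `deg F ≤ d`**: `F = Σ_{m ∈ supp F} c_m · monomial m = Σ c_m hcoef(m)⁻¹ · ζ_m` and `B⁻¹ζ_m = h_m` (★ `binvPi_zeta`), with
`|m| ≤ deg F ≤ d` on the support. [cite: Folland1989, §1.7] -/
theorem binvPi_mem_span_hermitePi {d : ℕ} {F : MvPolynomial ι ℂ} (hF : F.totalDegree ≤ d) :
    (binvPi F : 𝓢((ι → ℝ), ℂ)) ∈ Submodule.span ℂ {x : 𝓢((ι → ℝ), ℂ) | ∃ γ : ι →₀ ℕ, γ.degree ≤ d ∧ hermitePi γ = x} := by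
  rw [F.as_sum, ← binvPiₗ_apply, map_sum]
  refine Submodule.sum_mem _ fun m hm => ?_
  have hdeg : m.degree ≤ d := (sum_eq_degree m ▸ MvPolynomial.le_totalDegree hm).trans hF
  have hmon : (MvPolynomial.monomial m (MvPolynomial.coeff m F) : MvPolynomial ι ℂ) =
      (MvPolynomial.coeff m F * ((hcoef m : ℂ)⁻¹)) • zeta m := by
    rw [mul_smul, ← monomial_one_eq_smul_zeta, MvPolynomial.smul_monomial, smul_eq_mul, mul_one]
  rw [binvPiₗ_apply, hmon, binvPi_smul, binvPi_zeta]
  exact Submodule.smul_mem _ _ (Submodule.subset_span ⟨m, hdeg, rfl⟩)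

/-- **Folland's `μ₀(U)` does not raise the Hermite degree**: `μ₀(U) h_β = B⁻¹(ζ_β ∘ U⁻¹) ∈ span {h_γ : |γ| ≤ |β|}` for every unitary `U`
(★ `unitaryOpPi_binvPi`; a linear substitution does not raise the total degree, ★ `totalDegree_linSubst_le`; `ζ_β` is homogeneous of degree `|β|`, ★ `isHomogeneous_zeta`).
[cite: Folland1989, Prop. (4.39)] [cite: Howe1989, §3] -/
theorem unitaryOpPi_hermitePi_mem_span (U : Matrix.unitaryGroup ι ℂ) (β : ι →₀ ℕ) :
    unitaryOpPi U (hermitePi β : 𝓢((ι → ℝ), ℂ)) ∈ Submodule.span ℂ {x : 𝓢((ι → ℝ), ℂ) | ∃ γ : ι →₀ ℕ, γ.degree ≤ β.degree ∧ hermitePi γ = x} := by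
  rw [← binvPi_zeta, unitaryOpPi_binvPi]
  exact binvPi_mem_span_hermitePi ((totalDegree_linSubst_le _ _).trans (isHomogeneous_zeta β).totalDegree_le)

end Generic

/-! ## §2 The junction Weil representation of `U(P,Q) × U(R,S)` on the maximal compact -/

section DualPair

variable {P Q R S : Type*} [Fintype P] [DecidableEq P] [Fintype Q] [DecidableEq Q] [Fintype R] [DecidableEq R]
  [Fintype S] [DecidableEq S]

/-- **`ω(κ k) h_β ∈ span {h_γ : |γ| ≤ |β|}` at EVERY signature**: on the maximal compact `K_V × K_W` the junction Weil representation `ω = weilRep ∘ toBig` acts by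
`(det d)⁻¹ · μ₀(ι k)` (★ `weilElt_toBig_κ_apply`), and `μ₀` preserves the Hermite degree (§1). [cite: KonnoKonno2007, §3.1, Lemma 5.2] [cite: Folland1989, Prop. (4.39)] -/
theorem weilRepPair_κ_hermitePi_mem_span (k : DPK P Q R S) (β : DPIdx P Q R S →₀ ℕ) :
    (weilRep (α := (P × R) ⊕ (Q × S)) (β := (P × S) ⊕ (Q × R))).comp (toBig P Q R S) (κ P Q R S k) (hermitePi β) ∈
      Submodule.span ℂ {x : 𝓢((DPIdx P Q R S → ℝ), ℂ) | ∃ γ : DPIdx P Q R S →₀ ℕ, γ.degree ≤ β.degree ∧ hermitePi γ = x} := by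
  rw [weilRepPair_apply, weilElt_toBig_κ_apply]
  exact Submodule.smul_mem _ _ (unitaryOpPi_hermitePi_mem_span _ _)

/-- **σ15's FOCK CLAUSE, LITERAL SHAPE**: for a frame compact `h = kV k₁`, `k₁ ∈ U(P) × U(Q)`, of the FIRST member, `ω((h, 1)) h_β ∈ span {h_γ : |γ| ≤ |β|}`
(`(kV k₁, 1) = κ (k₁, 1)`). [cite: KonnoKonno2007, §3.1, Lemma 5.2] [cite: Folland1989, Prop. (4.39)] -/
theorem weilRepPair_kV_one_hermitePi_mem_span (k₁ : Matrix.unitaryGroup P ℂ × Matrix.unitaryGroup Q ℂ) (β : DPIdx P Q R S →₀ ℕ) :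
    (weilRep (α := (P × R) ⊕ (Q × S)) (β := (P × S) ⊕ (Q × R))).comp (toBig P Q R S) ((UForm.kV P Q k₁, (1 : UForm R S)) : Ginf P Q R S) (hermitePi β) ∈
      Submodule.span ℂ {x : 𝓢((DPIdx P Q R S → ℝ), ℂ) | ∃ γ : DPIdx P Q R S →₀ ℕ, γ.degree ≤ β.degree ∧ hermitePi γ = x} := by
  have h : ((UForm.kV P Q k₁, (1 : UForm R S)) : Ginf P Q R S) = κ P Q R S (k₁, 1) := by
    refine Prod.ext rfl ?_
    show (1 : UForm R S) = UForm.kV R S 1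
    rw [map_one]
  rw [h]
  exact weilRepPair_κ_hermitePi_mem_span _ _

end DualPair

/-! ## §3 σ15 and the (real) clause with the BARE inclusion `hK₀` -/

section Sigma15

variable (L : Type) [Field L] [NumberField L] [IsCMField L]
variable {N M n : ℕ} (e : Fin N × Fin M ≃ Fin n)
  (dV : Fin N → L) (hdV : ∀ i, IsCMField.complexConj L (dV i) = dV i) (hdV0 : ∀ i, dV i ≠ 0)
  (dW : Fin M → L) (hdW : ∀ i, IsCMField.complexConj L (dW i) = dW i) (hdW0 : ∀ i, dW i ≠ 0)
variable {M₂ M' n' : ℕ} (eW : Fin M × Fin M₂ ≃ Fin M') (e' : Fin N × Fin M' ≃ Fin n')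
  (dV' : Fin M₂ → L) (hdV' : ∀ k, IsCMField.complexConj L (dV' k) = dV' k) (hdV'0 : ∀ k, dV' k ≠ 0)

-- the doubled metaplectic carrier of the big datum and the CM sign frames elaborate slowly (as ★ σ15)
set_option maxHeartbeats 4000000

include hdW0 in
/-- **σ15 WITH THE BARE INCLUSION**: the Hermite span `V_D` is an arch datum for every `𝒦` whose arch part lies in the submonoid generated by the frame compacts
`placeSec_𝔻 σ (kV k₁)`, `k₁ ∈ U(p_σ) × U(q_σ)` (binder `hK₀`; the Fock property of ★ σ15's `hK` is §2). All other binders = ★ σ15's, byte for byte.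
[cite: Folland1989, §1.7, Prop. (4.39)] [cite: Howe1989, §3] [cite: HarrisKudlaSweet1996, §1 (1.15)–(1.17)] [cite: KonnoKonno2007, §3.3 p. 47] -/
theorem isArchDatum_hermiteSpan_of_closure_kV {χ : HeckeCharacter L} (hχu : χ.IsUnitary) (hχs : IsSplittingChar L 1 χ)
    {sB : HA L e' dV hdV (tensorFrame L dW eW dV') (tensorFrame_real L dW hdW eW dV' hdV') →* MpD L e' dV hdV (tensorFrame L dW eW dV') (tensorFrame_real L dW hdW eW dV' hdV')}
    (hsB : IsDoubledWeilRep L e' dV hdV hdV0 (tensorFrame L dW eW dV') (tensorFrame_real L dW hdW eW dV' hdV')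
      (tensorFrame_ne_zero L dW eW dV' hdW0 hdV'0) χ sB)
    {t : InfinitePlace L → ℤ} (ht : χ.HasUnitaryArchType t 0) (hodd : ∀ w, Odd (t w))
    (y : ∀ σ : {v : InfinitePlace (Fp L) // v.IsReal}, Fin M₂ → ℝ)
    (hy : ∀ σ : {v : InfinitePlace (Fp L) // v.IsReal}, ∀ k, (y σ) k ≠ 0)
    (hz : ∀ σ : {v : InfinitePlace (Fp L) // v.IsReal}, ∀ j, signVec (cmPlaceOver L)
        (fun k => Sum.elim (cmGramEntry L e' dV hdV (tensorFrame L dW eW dV') (tensorFrame_real L dW hdW eW dV' hdV'))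
          (-cmGramEntry L e' dV hdV (tensorFrame L dW eW dV') (tensorFrame_real L dW hdW eW dV' hdV')) ((LocalSplitting.e₂ n').symm k))
        (imagUnit L) σ j =
      signVec (cmPlaceOver L)
          (fun k => Sum.elim (cmGramEntry L e dV hdV dW hdW) (-cmGramEntry L e dV hdV dW hdW) ((LocalSplitting.e₂ n).symm k)) (imagUnit L) σ
          ((epsD e eW e').symm j).1 * (y σ) ((epsD e eW e').symm j).2)
    (eP : ∀ σ : {v : InfinitePlace (Fp L) // v.IsReal}, (PosIdx (signVec (cmPlaceOver L)
          (fun k => Sum.elim (cmGramEntry L e dV hdV dW hdW) (-cmGramEntry L e dV hdV dW hdW) ((LocalSplitting.e₂ n).symm k)) (imagUnit L) σ) × PosIdx (y σ)) ⊕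
        (NegIdx (signVec (cmPlaceOver L)
          (fun k => Sum.elim (cmGramEntry L e dV hdV dW hdW) (-cmGramEntry L e dV hdV dW hdW) ((LocalSplitting.e₂ n).symm k)) (imagUnit L) σ) × NegIdx (y σ)) ≃
      PosIdx (signVec (cmPlaceOver L)
        (fun k => Sum.elim (cmGramEntry L e' dV hdV (tensorFrame L dW eW dV') (tensorFrame_real L dW hdW eW dV' hdV'))
          (-cmGramEntry L e' dV hdV (tensorFrame L dW eW dV') (tensorFrame_real L dW hdW eW dV' hdV')) ((LocalSplitting.e₂ n').symm k))
        (imagUnit L) σ))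
    (eQ : ∀ σ : {v : InfinitePlace (Fp L) // v.IsReal}, (PosIdx (signVec (cmPlaceOver L)
          (fun k => Sum.elim (cmGramEntry L e dV hdV dW hdW) (-cmGramEntry L e dV hdV dW hdW) ((LocalSplitting.e₂ n).symm k)) (imagUnit L) σ) × NegIdx (y σ)) ⊕
        (NegIdx (signVec (cmPlaceOver L)
          (fun k => Sum.elim (cmGramEntry L e dV hdV dW hdW) (-cmGramEntry L e dV hdV dW hdW) ((LocalSplitting.e₂ n).symm k)) (imagUnit L) σ) × PosIdx (y σ)) ≃
      NegIdx (signVec (cmPlaceOver L)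
        (fun k => Sum.elim (cmGramEntry L e' dV hdV (tensorFrame L dW eW dV') (tensorFrame_real L dW hdW eW dV' hdV'))
          (-cmGramEntry L e' dV hdV (tensorFrame L dW eW dV') (tensorFrame_real L dW hdW eW dV' hdV')) ((LocalSplitting.e₂ n').symm k))
        (imagUnit L) σ))
    (hE : ∀ σ : {v : InfinitePlace (Fp L) // v.IsReal}, ∀ i, (dpEquiv _ _ _ _).symm (((eP σ).sumCongr (eQ σ)).symm i) =
      (signSplit (signVec (cmPlaceOver L)
          (fun k => Sum.elim (cmGramEntry L e dV hdV dW hdW) (-cmGramEntry L e dV hdV dW hdW) ((LocalSplitting.e₂ n).symm k)) (imagUnit L) σ)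
        ((epsD e eW e').symm ((signSplit (signVec (cmPlaceOver L)
          (fun k => Sum.elim (cmGramEntry L e' dV hdV (tensorFrame L dW eW dV') (tensorFrame_real L dW hdW eW dV' hdV'))
            (-cmGramEntry L e' dV hdV (tensorFrame L dW eW dV') (tensorFrame_real L dW hdW eW dV' hdV')) ((LocalSplitting.e₂ n').symm k))
          (imagUnit L) σ)).symm i)).1,
       signSplit (y σ) ((epsD e eW e').symm ((signSplit (signVec (cmPlaceOver L)
          (fun k => Sum.elim (cmGramEntry L e' dV hdV (tensorFrame L dW eW dV') (tensorFrame_real L dW hdW eW dV' hdV'))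
            (-cmGramEntry L e' dV hdV (tensorFrame L dW eW dV') (tensorFrame_real L dW hdW eW dV' hdV')) ((LocalSplitting.e₂ n').symm k))
          (imagUnit L) σ)).symm i)).2))
    (𝒦 : IwasawaDatum L e dV hdV dW hdW)
    (hK₀ : ∀ ainf : UnitaryGroup.arch (Fp L) L (IsCMField.complexConj L) (n + n) (hermD L e dV hdV dW hdW),
      (UnitaryGroup.archToAdelic (Fp L) L (IsCMField.complexConj L) (n + n) (hermD L e dV hdV dW hdW) ainf : HA L e dV hdV dW hdW) ∈ 𝒦.K →
      ainf ∈ Submonoid.closure {k : UnitaryGroup.arch (Fp L) L (IsCMField.complexConj L) (n + n) (hermD L e dV hdV dW hdW) |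
        ∃ (σ : {v : InfinitePlace (Fp L) // v.IsReal}) (k₁ : Matrix.unitaryGroup (PosIdx (signVec (cmPlaceOver L) (fun k => Sum.elim (cmGramEntry L e dV hdV dW hdW) (-cmGramEntry L e dV hdV dW hdW) ((LocalSplitting.e₂ n).symm k)) (imagUnit L) σ)) ℂ × Matrix.unitaryGroup (NegIdx (signVec (cmPlaceOver L) (fun k => Sum.elim (cmGramEntry L e dV hdV dW hdW) (-cmGramEntry L e dV hdV dW hdW) ((LocalSplitting.e₂ n).symm k)) (imagUnit L) σ)) ℂ),
          k = (placeSec L (IsCMField.complexConj L) (n + n) (IsCMField.complexConj_ne_one L) (cmPlaceOver L) (cmPlaceOver_smul L) _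
          (gramD_gram_realDiagonal_entry_ne_zero L e dV hdV dW hdW hdV0 hdW0) (complexConj_imagUnit L) (imagUnit_ne_zero L) σ
          (cmPlaceOver_comap L) (gramD_eq_diagonal_cm L e dV hdV dW hdW) (J := hermD L e dV hdV dW hdW) rfl
          (complexConj_smul_infinitePlace L) (UForm.kV _ _ k₁))})
    (D : ℕ) :
    IsArchDatum L e dV hdV dW hdW eW e' dV' hdV' sB 𝒦 (Submodule.span ℂ {x : 𝓢((Fin (n' + n') → mixedSpace (Fp L)), ℂ) | ∃ γ : (Fin (n' + n') × {v : InfinitePlace (Fp L) // v.IsReal}) →₀ ℕ, γ.degree ≤ D ∧ follandHermite (GRConstruction.frameD L e' dV hdV hdV0 (tensorFrame L dW eW dV') (tensorFrame_real L dW hdW eW dV' hdV') (tensorFrame_ne_zero L dW eW dV' hdW0 hdV'0)) γ = x}) := by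
  refine isArchDatum_hermiteSpan L e dV hdV hdV0 dW hdW hdW0 eW e' dV' hdV' hdV'0 hχu hχs hsB ht hodd y hy hz eP eQ hE 𝒦 (fun ainf hainf => ?_) D
  refine Submonoid.closure_mono ?_ (hK₀ ainf hainf)
  rintro k ⟨σ, k₁, rfl⟩
  exact ⟨σ, UForm.kV _ _ k₁, fun β₁ => weilRepPair_kV_one_hermitePi_mem_span k₁ β₁, rfl⟩

include hdW0 in
/-- **THE (real) CLAUSE WITH THE BARE INCLUSION**: ★ `K2LiuArchSWSystemRealiser.realiser_of_hK` with `hK` replaced by `hK₀` (same currency `𝔉 ∕ Φ_𝓢 ∕ val ∕ Y`).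
[cite: Folland1989, §1.7, Prop. (4.39)] [cite: HarrisKudlaSweet1996, §1 (1.15)–(1.17)] [cite: KudlaRallis1994, §1] -/
theorem realiser_of_closure_kV {χ : HeckeCharacter L} (hχu : χ.IsUnitary) (hχs : IsSplittingChar L 1 χ)
    {sB : HA L e' dV hdV (tensorFrame L dW eW dV') (tensorFrame_real L dW hdW eW dV' hdV') →* MpD L e' dV hdV (tensorFrame L dW eW dV') (tensorFrame_real L dW hdW eW dV' hdV')}
    (hsB : IsDoubledWeilRep L e' dV hdV hdV0 (tensorFrame L dW eW dV') (tensorFrame_real L dW hdW eW dV' hdV')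
      (tensorFrame_ne_zero L dW eW dV' hdW0 hdV'0) χ sB)
    {t : InfinitePlace L → ℤ} (ht : χ.HasUnitaryArchType t 0) (hodd : ∀ w, Odd (t w))
    (y : ∀ σ : {v : InfinitePlace (Fp L) // v.IsReal}, Fin M₂ → ℝ)
    (hy : ∀ σ : {v : InfinitePlace (Fp L) // v.IsReal}, ∀ k, (y σ) k ≠ 0)
    (hz : ∀ σ : {v : InfinitePlace (Fp L) // v.IsReal}, ∀ j, signVec (cmPlaceOver L)
        (fun k => Sum.elim (cmGramEntry L e' dV hdV (tensorFrame L dW eW dV') (tensorFrame_real L dW hdW eW dV' hdV'))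
          (-cmGramEntry L e' dV hdV (tensorFrame L dW eW dV') (tensorFrame_real L dW hdW eW dV' hdV')) ((LocalSplitting.e₂ n').symm k))
        (imagUnit L) σ j =
      signVec (cmPlaceOver L)
          (fun k => Sum.elim (cmGramEntry L e dV hdV dW hdW) (-cmGramEntry L e dV hdV dW hdW) ((LocalSplitting.e₂ n).symm k)) (imagUnit L) σ
          ((epsD e eW e').symm j).1 * (y σ) ((epsD e eW e').symm j).2)
    (eP : ∀ σ : {v : InfinitePlace (Fp L) // v.IsReal}, (PosIdx (signVec (cmPlaceOver L)
          (fun k => Sum.elim (cmGramEntry L e dV hdV dW hdW) (-cmGramEntry L e dV hdV dW hdW) ((LocalSplitting.e₂ n).symm k)) (imagUnit L) σ) × PosIdx (y σ)) ⊕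
        (NegIdx (signVec (cmPlaceOver L)
          (fun k => Sum.elim (cmGramEntry L e dV hdV dW hdW) (-cmGramEntry L e dV hdV dW hdW) ((LocalSplitting.e₂ n).symm k)) (imagUnit L) σ) × NegIdx (y σ)) ≃
      PosIdx (signVec (cmPlaceOver L)
        (fun k => Sum.elim (cmGramEntry L e' dV hdV (tensorFrame L dW eW dV') (tensorFrame_real L dW hdW eW dV' hdV'))
          (-cmGramEntry L e' dV hdV (tensorFrame L dW eW dV') (tensorFrame_real L dW hdW eW dV' hdV')) ((LocalSplitting.e₂ n').symm k))
        (imagUnit L) σ))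
    (eQ : ∀ σ : {v : InfinitePlace (Fp L) // v.IsReal}, (PosIdx (signVec (cmPlaceOver L)
          (fun k => Sum.elim (cmGramEntry L e dV hdV dW hdW) (-cmGramEntry L e dV hdV dW hdW) ((LocalSplitting.e₂ n).symm k)) (imagUnit L) σ) × NegIdx (y σ)) ⊕
        (NegIdx (signVec (cmPlaceOver L)
          (fun k => Sum.elim (cmGramEntry L e dV hdV dW hdW) (-cmGramEntry L e dV hdV dW hdW) ((LocalSplitting.e₂ n).symm k)) (imagUnit L) σ) × PosIdx (y σ)) ≃
      NegIdx (signVec (cmPlaceOver L)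
        (fun k => Sum.elim (cmGramEntry L e' dV hdV (tensorFrame L dW eW dV') (tensorFrame_real L dW hdW eW dV' hdV'))
          (-cmGramEntry L e' dV hdV (tensorFrame L dW eW dV') (tensorFrame_real L dW hdW eW dV' hdV')) ((LocalSplitting.e₂ n').symm k))
        (imagUnit L) σ))
    (hE : ∀ σ : {v : InfinitePlace (Fp L) // v.IsReal}, ∀ i, (dpEquiv _ _ _ _).symm (((eP σ).sumCongr (eQ σ)).symm i) =
      (signSplit (signVec (cmPlaceOver L)
          (fun k => Sum.elim (cmGramEntry L e dV hdV dW hdW) (-cmGramEntry L e dV hdV dW hdW) ((LocalSplitting.e₂ n).symm k)) (imagUnit L) σ)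
        ((epsD e eW e').symm ((signSplit (signVec (cmPlaceOver L)
          (fun k => Sum.elim (cmGramEntry L e' dV hdV (tensorFrame L dW eW dV') (tensorFrame_real L dW hdW eW dV' hdV'))
            (-cmGramEntry L e' dV hdV (tensorFrame L dW eW dV') (tensorFrame_real L dW hdW eW dV' hdV')) ((LocalSplitting.e₂ n').symm k))
          (imagUnit L) σ)).symm i)).1,
       signSplit (y σ) ((epsD e eW e').symm ((signSplit (signVec (cmPlaceOver L)
          (fun k => Sum.elim (cmGramEntry L e' dV hdV (tensorFrame L dW eW dV') (tensorFrame_real L dW hdW eW dV' hdV'))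
            (-cmGramEntry L e' dV hdV (tensorFrame L dW eW dV') (tensorFrame_real L dW hdW eW dV' hdV')) ((LocalSplitting.e₂ n').symm k))
          (imagUnit L) σ)).symm i)).2))
    (𝒦 : IwasawaDatum L e dV hdV dW hdW)
    (hK₀ : ∀ ainf : UnitaryGroup.arch (Fp L) L (IsCMField.complexConj L) (n + n) (hermD L e dV hdV dW hdW),
      (UnitaryGroup.archToAdelic (Fp L) L (IsCMField.complexConj L) (n + n) (hermD L e dV hdV dW hdW) ainf : HA L e dV hdV dW hdW) ∈ 𝒦.K →
      ainf ∈ Submonoid.closure {k : UnitaryGroup.arch (Fp L) L (IsCMField.complexConj L) (n + n) (hermD L e dV hdV dW hdW) |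
        ∃ (σ : {v : InfinitePlace (Fp L) // v.IsReal}) (k₁ : Matrix.unitaryGroup (PosIdx (signVec (cmPlaceOver L) (fun k => Sum.elim (cmGramEntry L e dV hdV dW hdW) (-cmGramEntry L e dV hdV dW hdW) ((LocalSplitting.e₂ n).symm k)) (imagUnit L) σ)) ℂ × Matrix.unitaryGroup (NegIdx (signVec (cmPlaceOver L) (fun k => Sum.elim (cmGramEntry L e dV hdV dW hdW) (-cmGramEntry L e dV hdV dW hdW) ((LocalSplitting.e₂ n).symm k)) (imagUnit L) σ)) ℂ),
          k = (placeSec L (IsCMField.complexConj L) (n + n) (IsCMField.complexConj_ne_one L) (cmPlaceOver L) (cmPlaceOver_smul L) _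
          (gramD_gram_realDiagonal_entry_ne_zero L e dV hdV dW hdW hdV0 hdW0) (complexConj_imagUnit L) (imagUnit_ne_zero L) σ
          (cmPlaceOver_comap L) (gramD_eq_diagonal_cm L e dV hdV dW hdW) (J := hermD L e dV hdV dW hdW) rfl
          (complexConj_smul_infinitePlace L) (UForm.kV _ _ k₁))})
    (Y : LocalSBFamily (Fp L) (Fin (n' + n'))) (Φ : ((Fin (n' + n') × {v : InfinitePlace (Fp L) // v.IsReal}) →₀ ℕ) →₀ ℂ) :
    ∃ (V : Submodule ℂ (SchwartzMap (Fin (n' + n') → mixedEmbedding.mixedSpace (Fp L)) ℂ))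
      (ΦS : SchwartzMap (Fin (n' + n') → mixedEmbedding.mixedSpace (Fp L)) ℂ) (Y' : LocalSBFamily (Fp L) (Fin (n' + n'))),
      IsArchDatum L e dV hdV dW hdW eW e' dV' hdV' sB 𝒦 V ∧ ΦS ∈ V ∧
      ∀ a : UnitaryGroup.arch (Fp L) L (IsCMField.complexConj L) (n + n) (hermD L e dV hdV dW hdW),
        archSWValue L e dV hdV hdV0 dW hdW hdW0 eW e' dV' hdV' hdV'0 sB Y' ΦS a =
          ((archSWValueLinear L e dV hdV hdV0 dW hdW hdW0 eW e' dV' hdV' hdV'0 sB Y).comp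
            (Finsupp.linearCombination ℂ fun γ : (Fin (n' + n') × {v : InfinitePlace (Fp L) // v.IsReal}) →₀ ℕ =>
              follandHermite (GRConstruction.frameD L e' dV hdV hdV0 (tensorFrame L dW eW dV') (tensorFrame_real L dW hdW eW dV' hdV') (tensorFrame_ne_zero L dW eW dV' hdW0 hdV'0)) γ)) Φ a := by
  refine realiser_of_hK L e dV hdV hdV0 dW hdW hdW0 eW e' dV' hdV' hdV'0 hχu hχs hsB ht hodd y hy hz eP eQ hE 𝒦 (fun ainf hainf => ?_) Y Φ
  refine Submonoid.closure_mono ?_ (hK₀ ainf hainf)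
  rintro k ⟨σ, k₁, rfl⟩
  exact ⟨σ, UForm.kV _ _ k₁, fun β₁ => weilRepPair_kV_one_hermitePi_mem_span k₁ β₁, rfl⟩

end Sigma15

end Summit.HodgeConjecture.HodgeConjecture.Cruxes.HLiu418.K2LiuArchPlaceSecFockDegree

end
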